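import Summits.AnomalousDissipation.AnomalousDissipation.Theorems.StirringSphereEnsembleRealizationStubRestartTranslate
import Literature.Analysis.FluidPDE.LerayHopfRestartTorus
import Literature.Analysis.FluidPDE.NSHopfWeakConvergence

/-!
# Crux `EnsembleRealization` (stmt-AnomalousDissipation-0215) — line `augmented-lift`,
# stub `stub_restart` (step B-a): restart of a realised path at a good time (PROVED)

Supports stmt-AnomalousDissipation-0215 (registered stub `stub_restart` of line `augmented-lift`;
the reshaped skeleton composes `stub_augmentedLaw` + `stub_restart` into the former stub B
`stub_augmentedLift`). Nothing here closes an item.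

Main result `stub_restart`: a finite-energy weak solution on `[0, ∞)` whose Fourier coefficients
are those of a path of a trajectory space `𝒦(R, L)` (`MomentParityDefs.pathSpace`), with locally
finite enstrophy and the energy inequality from almost every time, restarts at some `s ≥ 0` as a
GLOBAL LERAY–HOPF solution. Ingredients: the field of a path is weakly `L²`-continuous
(`continuousOn_integral_inner_pathField`) and bounded in energy (`lintegral_enorm_sq_pathField_le`);
strong right-continuity at a time from which the energy almost decreases
(`tendsto_eLpNorm_sub_pathField_of_le_add`, Robinson–Rodrigo–Sadowski 2016 Cor. 4.8); the weak
formulation of the translate (`isWeakNSSolutionForcedOn_translate_of_weak`, tools file); assembly as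
in `Torus.IsGlobalLerayHopf.isGlobalLerayHopf_translate`.
-/

noncomputable section

set_option linter.dupNamespace false

open MeasureTheory TopologicalSpace Set Function Filter Topology InnerProductSpace UnitAddTorus
open scoped RealInnerProductSpace ENNReal NNReal

namespace Summit.AnomalousDissipation.AnomalousDissipation.Theorems.EnsembleRealization

open Literature.Analysis.FunctionSpaces Literature.Analysis.FunctionSpaces.Torus
open Literature.Analysis.FluidPDE Literature.Analysis.FluidPDE.Torus

variable {ν : ℝ}

/-! ### Weak `L²` continuity of the field of a path

(Paths are denoted `γ` in this file: `ω` is the scoped `ContDiff` notation for analyticity.) -/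

section WeakContinuity

open scoped BigOperators InnerProductSpace
open Summit.AnomalousDissipation.AnomalousDissipation.Theorems.MomentParity


/-- **The field of a path of `𝒦` is weakly continuous into `L²`.** If `v t ∈ L²` has the Fourier
coefficients `γ̄(s + t, ·)` of a path `γ ∈ 𝒦(R, L)` for every `t ≥ 0`, then
`t ↦ ∫ ⟪v (max t 0), a⟫` is continuous on `ℝ` for every `a ∈ L²` (coefficientwise continuity of
`pathExt`, the uniform bound `∫ ‖v t‖² = pathEnergyTot γ (s + t) ≤ R²`, and weak convergence from
coefficientwise convergence under a uniform `L²` bound). -/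
theorem continuous_integral_inner_pathField {R : ℝ} {L : (Fin 3 → ℤ) → ℝ} {γ : Path (Fin 3)}
    (hγ : γ ∈ pathSpace R L) {s : ℝ}
    {v : ℝ → UnitAddTorus (Fin 3) → EuclideanSpace ℝ (Fin 3)}
    (hv : ∀ t, 0 ≤ t → MemLp (v t) 2 volume ∧
      ∀ k, mFourierCoeff (EuclideanSpace.complexify ∘ v t) k = pathExt γ (s + t) k)
    {a : UnitAddTorus (Fin 3) → EuclideanSpace ℝ (Fin 3)} (ha : MemLp a 2 volume) :
    Continuous fun t : ℝ => ∫ x, ⟪v (max t 0) x, a x⟫_ℝ := by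
  have hmem : ∀ t : ℝ, MemLp (v (max t 0)) 2 volume := fun t => (hv _ (le_max_right t 0)).1
  have hcoef : ∀ (t : ℝ) k, mFourierCoeff (EuclideanSpace.complexify ∘ v (max t 0)) k =
      pathExt γ (s + max t 0) k := fun t k => (hv _ (le_max_right t 0)).2 k
  -- the uniform `L²` bound `max (R²) (∫‖a‖²)`
  set Y : ℝ := max (R ^ 2) (∫ x, ‖a x‖ ^ 2) with hY
  have hYv : ∀ t : ℝ, ∫ x, ‖v (max t 0) x‖ ^ 2 ≤ Y := fun t => by
    rw [integral_norm_sq_eq_pathEnergyTot (hmem t) (hcoef t)]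
    exact (pathEnergyTot_le hγ _).trans (le_max_left _ _)
  refine continuous_iff_continuousAt.2 fun t => ?_
  rw [ContinuousAt, tendsto_iff_seq_tendsto]
  intro x hx
  -- coefficientwise convergence along the sequence
  have hc : ∀ k, Tendsto (fun n => mFourierCoeff (EuclideanSpace.complexify ∘ v (max (x n) 0)) k) atTop
      (𝓝 (mFourierCoeff (EuclideanSpace.complexify ∘ v (max t 0)) k)) := by
    intro k
    simp only [hcoef]
    have h1 : Tendsto (fun n => s + max (x n) 0) atTop (𝓝 (s + max t 0)) :=
      tendsto_const_nhds.add ((continuous_id.max continuous_const).continuousAt.tendsto.comp hx)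
    exact ((continuous_pathExt_time hγ k).continuousAt.tendsto).comp h1
  have h := Torus.tendsto_integral_inner_of_tendsto_mFourierCoeff (a := a) (fun n => hmem (x n)) (hmem t) ha
    (fun n => hYv (x n)) (hYv t) hc
  have hswap : ∀ t' : ℝ, ∫ x, ⟪v (max t' 0) x, a x⟫_ℝ = ∫ x, ⟪a x, v (max t' 0) x⟫_ℝ := fun t' =>
    integral_congr_ae (ae_of_all _ fun y => real_inner_comm _ _)
  simp only [Function.comp_def, hswap]
  exact h

/-- On `[0, ∞)` the previous statement reads: `t ↦ ∫ ⟪v t, a⟫` is continuous on `Ici 0`. -/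
theorem continuousOn_integral_inner_pathField {R : ℝ} {L : (Fin 3 → ℤ) → ℝ} {γ : Path (Fin 3)}
    (hγ : γ ∈ pathSpace R L) {s : ℝ}
    {v : ℝ → UnitAddTorus (Fin 3) → EuclideanSpace ℝ (Fin 3)}
    (hv : ∀ t, 0 ≤ t → MemLp (v t) 2 volume ∧
      ∀ k, mFourierCoeff (EuclideanSpace.complexify ∘ v t) k = pathExt γ (s + t) k)
    {a : UnitAddTorus (Fin 3) → EuclideanSpace ℝ (Fin 3)} (ha : MemLp a 2 volume) :
    ContinuousOn (fun t : ℝ => ∫ x, ⟪v t x, a x⟫_ℝ) (Ici 0) := by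
  refine ((continuous_integral_inner_pathField hγ hv ha).continuousOn (s := Ici 0)).congr ?_
  intro t ht
  simp only [max_eq_left (mem_Ici.1 ht)]

/-- **Uniform energy bound of the field of a path** in `ℝ≥0∞`: `∫⁻ ‖v t‖ₑ² ≤ R²` for `t ≥ 0`
(extended Parseval and the energy clause of `𝒦`; the `energy_bound` clause of the restart step). -/
theorem lintegral_enorm_sq_pathField_le {R : ℝ} {L : (Fin 3 → ℤ) → ℝ} {γ : Path (Fin 3)}
    (hγ : γ ∈ pathSpace R L) {s : ℝ}
    {v : ℝ → UnitAddTorus (Fin 3) → EuclideanSpace ℝ (Fin 3)}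
    (hv : ∀ t, 0 ≤ t → MemLp (v t) 2 volume ∧
      ∀ k, mFourierCoeff (EuclideanSpace.complexify ∘ v t) k = pathExt γ (s + t) k)
    {t : ℝ} (ht : 0 ≤ t) : ∫⁻ x, ‖v t x‖ₑ ^ 2 ≤ ENNReal.ofReal (R ^ 2) := by
  rw [← tsum_enorm_sq_mFourierCoeff_complexify (hv t ht).1]
  simp only [(hv t ht).2]
  exact tsum_enorm_pathExt_sq_le hγ (s + t)

/-- **Strong `L²` right-continuity of the field of a path at a time from which the energy almost
decreases** (Robinson–Rodrigo–Sadowski 2016, Cor. 4.8, for the field of a path of `𝒦`: the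
`strong_initial` clause of the restart step B-a). If `E(v t) ≤ E(v s) + ρ(t)` for `t ≥ s ≥ 0`
with `ρ(t) → 0` as `t → s⁺`, then `‖v t - v s‖_{L²} → 0` as `t → s⁺`:
`2E(v t - v s) = 2E(v t) - 2∫⟪v t, v s⟫ + 2E(v s) → 0` by the weak continuity
`continuousOn_integral_inner_pathField` tested against `v s`. Proof adapted from
`Torus.IsLerayHopfOn.tendsto_eLpNorm_sub_nhdsGT_of_le_add` (fields `memLp`, `weak_continuous`
replaced by the path-field data). -/
theorem tendsto_eLpNorm_sub_pathField_of_le_add {R : ℝ} {L : (Fin 3 → ℤ) → ℝ} {γ : Path (Fin 3)}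
    (hγ : γ ∈ pathSpace R L) {s₀ : ℝ}
    {v : ℝ → UnitAddTorus (Fin 3) → EuclideanSpace ℝ (Fin 3)}
    (hv : ∀ t, 0 ≤ t → MemLp (v t) 2 volume ∧
      ∀ k, mFourierCoeff (EuclideanSpace.complexify ∘ v t) k = pathExt γ (s₀ + t) k)
    {s : ℝ} (hs : 0 ≤ s) {ρ : ℝ → ℝ} (hρ : Tendsto ρ (𝓝[>] s) (𝓝 0))
    (hE : ∀ t, s ≤ t → kineticEnergy (v t) ≤ kineticEnergy (v s) + ρ t) :
    Tendsto (fun t => eLpNorm (v t - v s) 2 volume) (𝓝[>] s) (𝓝 0) := by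
  have hvs : MemLp (v s) 2 volume := (hv s hs).1
  set P : ℝ → ℝ := fun t => ∫ x, ⟪v t x, v s x⟫_ℝ with hP
  -- weak continuity tested against `v s`
  have hPc : Tendsto P (𝓝[>] s) (𝓝 (P s)) := by
    have h1 : ContinuousWithinAt P (Ici 0) s :=
      continuousOn_integral_inner_pathField hγ hv hvs s (mem_Ici.2 hs)
    exact h1.tendsto.mono_left (nhdsWithin_mono s fun t ht => hs.trans (le_of_lt ht))
  have hPs : P s = 2 * kineticEnergy (v s) := by
    simp only [hP, kineticEnergy, real_inner_self_eq_norm_sq]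
    ring
  -- the energy of the difference tends to zero
  have hev : ∀ᶠ t in 𝓝[>] s, s < t := self_mem_nhdsWithin
  have hKE : Tendsto (fun t => kineticEnergy (v t - v s)) (𝓝[>] s) (𝓝 0) := by
    have hup : Tendsto (fun t => 2 * kineticEnergy (v s) + ρ t - P t) (𝓝[>] s) (𝓝 0) := by
      have := ((tendsto_const_nhds (x := 2 * kineticEnergy (v s))).add hρ).sub hPc
      rwa [hPs, add_zero, sub_self] at this
    refine tendsto_of_tendsto_of_tendsto_of_le_of_le' tendsto_const_nhds hup ?_ ?_
    · exact Eventually.of_forall fun t => kineticEnergy_nonneg _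
    · filter_upwards [hev] with t ht
      have hut : MemLp (v t) 2 volume := (hv t (hs.trans ht.le)).1
      rw [kineticEnergy_sub hut hvs]
      have := hE t ht.le
      show kineticEnergy (v t) - P t + kineticEnergy (v s) ≤ 2 * kineticEnergy (v s) + ρ t - P t
      linarith
  -- convert to the `L²` norm
  have hE2 : Tendsto (fun t => ∫⁻ x, ‖(v t - v s) x‖ₑ ^ 2) (𝓝[>] s) (𝓝 0) := by
    have h1 : Tendsto (fun t => ENNReal.ofReal (2 * kineticEnergy (v t - v s))) (𝓝[>] s) (𝓝 0) := by
      have := ENNReal.tendsto_ofReal (hKE.const_mul 2)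
      rwa [mul_zero, ENNReal.ofReal_zero] at this
    refine h1.congr' ?_
    filter_upwards [hev] with t ht
    have hut : MemLp (v t) 2 volume := (hv t (hs.trans ht.le)).1
    rw [lintegral_enorm_sq_eq_ofReal (hut.sub hvs)]
    simp only [kineticEnergy]
    congr 1
    ring
  have h3 : Tendsto (fun t => (∫⁻ x, ‖(v t - v s) x‖ₑ ^ 2) ^ (2⁻¹ : ℝ)) (𝓝[>] s) (𝓝 0) := by
    have := (ENNReal.continuous_rpow_const (y := (2⁻¹ : ℝ))).tendsto 0 |>.comp hE2
    rwa [ENNReal.zero_rpow_of_pos (by norm_num)] at this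
  refine h3.congr fun t => ?_
  rw [eLpNorm_eq_lintegral_rpow_enorm_toReal two_ne_zero ENNReal.ofNat_ne_top]
  simp only [ENNReal.toReal_ofNat, one_div]
  congr 1
  refine lintegral_congr fun x => ?_
  rw [← ENNReal.rpow_natCast]
  norm_num

end WeakContinuity

/-! ### Step B-a: restart of a realised path at a good time -/

section Restart

open scoped BigOperators InnerProductSpace
open Summit.AnomalousDissipation.AnomalousDissipation.Theorems.MomentParity

variable {f : UnitAddTorus (Fin 3) → EuclideanSpace ℝ (Fin 3)}

/-- **Stub B-a (restart), PROVED.** A finite-energy weak solution on `[0, ∞)` whose Fourier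
coefficients are those of a path of a trajectory space `𝒦(R, L)` (hence weakly continuous into
`L²` and bounded by `R`), with locally finite enstrophy and the energy inequality from almost
every time, restarts at some `s ≥ 0` as a GLOBAL LERAY–HOPF solution from `v s`
(Robinson–Rodrigo–Sadowski 2016, Def. 4.9 and p. 131; Leray 1934, §III (5.1)–(5.2)). -/
theorem stub_restart (hν : 0 < ν) (hf : IsSmooth f)
    {R : ℝ} {L : (Fin 3 → ℤ) → ℝ} {ω : Path (Fin 3)} (hω : ω ∈ pathSpace R L)
    {v : ℝ → UnitAddTorus (Fin 3) → EuclideanSpace ℝ (Fin 3)}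
    (hcoef : ∀ t, 0 ≤ t → MemLp (v t) 2 volume ∧
      ∀ k, mFourierCoeff (EuclideanSpace.complexify ∘ v t) k = pathExt ω t k)
    (hweak : ∀ T, 0 < T → IsWeakNSSolutionForcedOn T ν (fun _ => f) (v 0) v)
    (hsob : ∀ T, 0 < T → MemL2Sobolev 0 T 1 (fun t => EuclideanSpace.complexify ∘ v t))
    (hEI : ∀ᵐ s ∂(volume.restrict (Ioi (0 : ℝ))), ∀ t, s ≤ t →
      kineticEnergy (v t) + ν * (∫⁻ τ in Ioo s t, eGradNormSq (v τ)).toReal ≤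
        kineticEnergy (v s) + ∫ τ in s..t, ∫ x, ⟪f x, v τ x⟫_ℝ) :
    ∃ s : ℝ, 0 ≤ s ∧ ∃ u : ℝ → UnitAddTorus (Fin 3) → EuclideanSpace ℝ (Fin 3),
      IsGlobalLerayHopf ν (fun _ => f) (u 0) u ∧
      ∀ t, 0 ≤ t → MemLp (u t) 2 volume ∧
        ∀ k, mFourierCoeff (EuclideanSpace.complexify ∘ u t) k = pathExt ω (s + t) k := by
  -- the coefficient data in the form `pathExt ω (0 + t)`
  have hv : ∀ t, 0 ≤ t → MemLp (v t) 2 volume ∧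
      ∀ k, mFourierCoeff (EuclideanSpace.complexify ∘ v t) k = pathExt ω (0 + t) k := fun t ht =>
    ⟨(hcoef t ht).1, fun k => by rw [zero_add]; exact (hcoef t ht).2 k⟩
  have hf2 : MemLp f 2 volume := hf.memLp 2
  -- a good time `s ∈ (0, 1)`
  have hEI' : ∀ᵐ s ∂(volume.restrict (Ioo (0 : ℝ) 1)), ∀ t, s ≤ t →
      kineticEnergy (v t) + ν * (∫⁻ τ in Ioo s t, eGradNormSq (v τ)).toReal ≤
        kineticEnergy (v s) + ∫ τ in s..t, ∫ x, ⟪f x, v τ x⟫_ℝ :=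
    ae_mono (Measure.restrict_mono Ioo_subset_Ioi_self le_rfl) hEI
  obtain ⟨s, hs01, hEs⟩ := exists_mem_Ioo_of_ae_Ioo one_pos le_rfl hEI'
  have hs : 0 < s := hs01.1
  -- the work of the force along `v` is bounded: `|∫⟪f, v τ⟫| ≤ ‖f‖₂ |R|`
  set W : ℝ → ℝ := fun τ => ∫ x, ⟪f x, v τ x⟫_ℝ with hW
  set B : ℝ := Real.sqrt (∫ x, ‖f x‖ ^ 2) * Real.sqrt (R ^ 2) with hB
  have hWb : ∀ τ, 0 ≤ τ → |W τ| ≤ B := fun τ hτ => by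
    refine (abs_integral_inner_le_of_coef (hcoef τ hτ).1 (hcoef τ hτ).2 hf2).trans ?_
    exact mul_le_mul_of_nonneg_left (Real.sqrt_le_sqrt (pathEnergyTot_le hω τ)) (Real.sqrt_nonneg _)
  have hB0 : 0 ≤ B := by positivity
  -- the remainder `ρ t = ∫ₛᵗ W` tends to zero at `s⁺`
  set ρ : ℝ → ℝ := fun t => ∫ τ in s..t, W τ with hρ
  have hρt : Tendsto ρ (𝓝[>] s) (𝓝 0) := by
    have hbound : ∀ t, s ≤ t → |ρ t| ≤ B * (t - s) := by
      intro t hst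
      have h := intervalIntegral.norm_integral_le_of_norm_le_const (a := s) (b := t) (C := B) (f := W)
        (fun τ hτ => by
          rw [uIoc_of_le hst] at hτ
          rw [Real.norm_eq_abs]
          exact hWb τ (hs.le.trans hτ.1.le))
      rw [Real.norm_eq_abs, abs_of_nonneg (sub_nonneg.2 hst)] at h
      exact h
    have hlin : Tendsto (fun t => B * (t - s)) (𝓝[>] s) (𝓝 0) := by
      have : Tendsto (fun t : ℝ => B * (t - s)) (𝓝 s) (𝓝 (B * (s - s))) :=
        (continuous_const.mul (continuous_id.sub continuous_const)).tendsto s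
      rw [sub_self, mul_zero] at this
      exact this.mono_left nhdsWithin_le_nhds
    rw [tendsto_zero_iff_abs_tendsto_zero]
    refine tendsto_of_tendsto_of_tendsto_of_le_of_le' tendsto_const_nhds hlin
      (Eventually.of_forall fun t => abs_nonneg _) ?_
    filter_upwards [self_mem_nhdsWithin] with t ht
    exact hbound t (le_of_lt ht)
  -- strong right-continuity at `s`
  have hE' : ∀ t, s ≤ t → kineticEnergy (v t) ≤ kineticEnergy (v s) + ρ t := by
    intro t hst
    have h1 := hEs t hst
    have h2 : 0 ≤ ν * (∫⁻ τ in Ioo s t, eGradNormSq (v τ)).toReal :=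
      mul_nonneg hν.le ENNReal.toReal_nonneg
    show kineticEnergy (v t) ≤ kineticEnergy (v s) + ∫ τ in s..t, W τ
    linarith
  have h0 : Tendsto (fun τ => eLpNorm (v τ - v s) 2 volume) (𝓝[>] s) (𝓝 0) :=
    tendsto_eLpNorm_sub_pathField_of_le_add hω hv hs.le hρt hE'
  -- the translate is a global Leray–Hopf solution from `v s`
  have hsh : Tendsto (fun t : ℝ => t + s) (𝓝[>] (0 : ℝ)) (𝓝 s) :=
    (tendsto_add_right_nhdsGT_zero s).mono_right nhdsWithin_le_nhds
  have hLH : IsGlobalLerayHopf ν (fun _ => f) (v s) (fun t => v (t + s)) := by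
    intro T hT
    have hsub : Ioo (0 + s) (T + s) ⊆ Ioo 0 (T + s) := fun t ht => ⟨by linarith [ht.1], ht.2⟩
    have hsubIoi : Ioo (0 + s) (T + s) ⊆ Ioi 0 := fun t ht => mem_Ioi.2 (by linarith [ht.1])
    have hμ : volume.restrict (Ioo (0 + s) (T + s)) ≤ volume.restrict (Ioo 0 (T + s)) :=
      Measure.restrict_mono hsub le_rfl
    have hmem : ∀ τ ∈ Icc s (s + T), MemLp (v τ) 2 volume := fun τ hτ => (hcoef τ (hs.le.trans hτ.1)).1
    obtain ⟨hS1, hS2⟩ := hsob (T + s) (by linarith)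
    set D : ℝ → ℝ≥0∞ := fun τ => eGradNormSq (v τ) with hD
    refine
      { weak := isWeakNSSolutionForcedOn_translate_of_weak (hweak (T + s) (by linarith)) hf hs hT hmem h0
        energy_bound := ⟨(R ^ 2).toNNReal, ?_⟩
        memLp := fun t ht => (hcoef (t + s) (by linarith [ht.1])).1
        memL2Sobolev := ⟨ae_restrict_Ioo_comp_add_right s (ae_mono hμ hS1), ?_⟩
        energy_ineq_zero := fun t ht => ?_
        energy_ineq_ae := ?_
        weak_continuous := fun w hw => ?_
        strong_initial := h0.comp (tendsto_add_right_nhdsGT_zero s) }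
    · -- `L^∞ L²`
      refine (ae_restrict_iff' measurableSet_Ioo).2 (ae_of_all _ fun t ht => ?_)
      have h := lintegral_enorm_sq_pathField_le hω hv (t := t + s) (by linarith [ht.1])
      rwa [ENNReal.ofReal] at h
    · -- `L² H¹`
      unfold eL2SobolevNorm at hS2 ⊢
      have hle : ∫⁻ t in Ioo 0 T, eSobolevNorm 1 (EuclideanSpace.complexify ∘ v (t + s)) ^ 2 ≤
          ∫⁻ t in Ioo 0 (T + s), eSobolevNorm 1 (EuclideanSpace.complexify ∘ v t) ^ 2 := by
        rw [setLIntegral_Ioo_comp_add_right (fun t => eSobolevNorm 1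
          (EuclideanSpace.complexify ∘ v t) ^ 2) 0 T s]
        exact lintegral_mono_set hsub
      exact lt_of_le_of_lt (ENNReal.rpow_le_rpow hle (by norm_num)) hS2
    · -- energy inequality from `0` (= from `s` for `v`)
      have h1 := hEs (t + s) (by linarith [ht.1])
      have h2 := intervalIntegral.integral_comp_add_right (a := (0 : ℝ)) (b := t) W s
      rw [zero_add] at h2
      show kineticEnergy (v (t + s)) + ν * (∫⁻ τ in Ioo 0 t, D (τ + s)).toReal ≤
        kineticEnergy (v s) + ∫ τ in (0 : ℝ)..t, W (τ + s)
      rw [setLIntegral_Ioo_comp_add_right D 0 t s, zero_add, h2]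
      exact h1
    · -- energy inequality from a.e. `s'`
      have hEIs : ∀ᵐ s' ∂(volume.restrict (Ioo (0 + s) (T + s))), ∀ t, s' ≤ t →
          kineticEnergy (v t) + ν * (∫⁻ τ in Ioo s' t, eGradNormSq (v τ)).toReal ≤
            kineticEnergy (v s') + ∫ τ in s'..t, W τ :=
        ae_mono (Measure.restrict_mono hsubIoi le_rfl) hEI
      have h1 := ae_restrict_Ioo_comp_add_right s hEIs
      filter_upwards [h1] with s' hs' t ht
      have h2 := intervalIntegral.integral_comp_add_right (a := s') (b := t) W s
      show kineticEnergy (v (t + s)) + ν * (∫⁻ τ in Ioo s' t, D (τ + s)).toReal ≤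
        kineticEnergy (v (s' + s)) + ∫ τ in s'..t, W (τ + s)
      rw [setLIntegral_Ioo_comp_add_right D s' t s, h2]
      exact hs' (t + s) (by linarith [ht.1])
    · -- weak `L²` continuity on `(0, T]` and the weak limit at `0⁺`
      have hco : ContinuousOn (fun t => ∫ x, ⟪v t x, w x⟫_ℝ) (Ici 0) :=
        continuousOn_integral_inner_pathField hω hv hw
      refine ⟨hco.comp (continuousOn_id.add continuousOn_const) fun t ht =>
        mem_Ici.2 (by linarith [ht.1]), ?_⟩
      have hca : ContinuousAt (fun t => ∫ x, ⟪v t x, w x⟫_ℝ) s :=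
        hco.continuousAt (Ici_mem_nhds hs)
      exact hca.tendsto.comp hsh
  refine ⟨s, hs.le, fun t => v (t + s), by simpa only [zero_add] using hLH, fun t ht => ?_⟩
  refine ⟨(hcoef (t + s) (by linarith)).1, fun k => ?_⟩
  rw [(hcoef (t + s) (by linarith)).2 k, add_comm]

end Restart

end Summit.AnomalousDissipation.AnomalousDissipation.Theorems.EnsembleRealization
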